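import Mathlib
import Summits.NavierStokesRegularity.OSWSelfSimilar.SheetHalfLineIdentity
import Summits.NavierStokesRegularity.OSWSelfSimilar.SheetHalfLineHilbertSign
import HarnessLib

/-!
# Viscous gCLM/OSW profile MODEL: the sign laws of the frozen-`ε` sheet with the GENUINE Hilbert transform
# (unconditional form of `SheetHalfLineIdentity` + `SheetHalfLineHilbertSign`)

HONEST FRAMING (cell ns-blowup GROUP B «PROFILE SEARCH», zone Z3 = the 1-D viscous gCLM/OSW sheet; human rulings
D-0035/D-0074): **1-D MODEL; not Euler, not Navier–Stokes; «violates: none — MODEL».** Nothing here is a statement about NS.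

OBJECT. The frozen-`ε` sheet map of HOME/profile/z3/SHEET.md §1.2,
`G(Ω; c_ω, c_l, a, ε) = c_ω Ω + c_l ξΩ′ + a𝒰Ω′ − (HΩ)Ω − εΩ″` (`= HouLuoOriginLaws.F1 … 1 … (fun _ => 0)`), now with the
stretching `H = hilbertTransform Ω` of `Literature/Analysis/Fourier/HilbertTransformLine.lean` (the MODEL's `u_x = Hω`) and
`𝒰′ = HΩ`. Combining the half-line identity (★) of `SheetHalfLineIdentity` with the kernel sign
`SheetHalfLine.integral_Ioi_hilbertTransform_mul_nonpos` (`∫₀^∞ (HΩ)Ω ≤ 0` for odd Lipschitz `Ω ∈ L¹ ∩ L²`):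

* `hilbert_trivial_of_nonpos_on_Ioi` — **on the collapse sheet `{c_l < c_ω}`, every `ε ≥ 0`, every `a ≤ −1`: an odd, Lipschitz,
  `L¹ ∩ L²`, `C²` profile in the (★) decay class with `Ω ≤ 0` on `(0,∞)` (the sign class of E½ and of every blow-up profile the
  cell has found) is `≡ 0`** — the E-signed class is EMPTY for `a ≤ −1` (KERNEL, (S)-side, MODEL), the steady every-`ε` companion
  of the printed PDE statement «`a ≤ −1` globally well-posed» (Chen 2020 Thm 1.5, `Λ^γ`, `γ ∈ [|a|⁻¹, 2]`; cited, not restated);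
* `hilbert_trivial_of_nonneg_on_Ioi` — for `a ≥ −1` the mirror class `Ω ≥ 0` on `(0,∞)` is EMPTY (steady shadow of Chen 2020
  Thm 1.3's sign dichotomy);
* `hilbert_trivial_of_oneSigned_of_a_eq_neg_one` — at `a = −1` (Córdoba–Córdoba–Fontelos) no one-signed profile at all.
Census reading (CENSUS-Z3 v2.2 §0 clause (i′), row Z3-E12⁻): «`a ≤ −1` EMPTY in PRINT» gains «+ KERNEL for the E-signed
profile class on the whole collapse sheet, every `ε`»; «`−1 < a < 0` NONE FOUND» is untouched (search word).
HYPOTHESES, PRINTED: `C²` as `HasDerivAt` everywhere; `Ω` odd, `K`-Lipschitz, `Ω ∈ L¹ ∩ L²` (E½-type profiles: bounded `Ω′`,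
tail `Aξ^{−c_ω/c_l}`); the decay class of (★) (`Ω, HΩ·Ω, ξΩ′, 𝒰Ω′, Ω″ ∈ L¹(0,∞)`, `ξΩ, 𝒰Ω, Ω′ → 0`); `F1 ≡ 0` on `(0,∞)`.
NOT PROVED: anything for `−1 < a < 0` beyond the sign law; anything about NS. bears_on: LADDER-NS N5 / Z3 (i′) → N1 linear core.
-/

noncomputable section
open Set Filter Topology MeasureTheory

namespace Summit.NavierStokesRegularity.OSWSelfSimilar
namespace SheetHalfLine
open HouLuoOriginLaws (F1)
open Literature.Analysis.Fourier (hilbertTransform)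

/-- **E-signed class EMPTY for `a ≤ −1` (genuine Hilbert transform).** On `{c_l < c_ω}`, `ε ≥ 0`, `a ≤ −1`: an odd `K`-Lipschitz
`Ω ∈ L¹ ∩ L²`, `C²`, solving the gCLM/OSW sheet equation with `H = hilbertTransform Ω`, `𝒰′ = HΩ` on `(0,∞)`, in the decay class of
(★), with `Ω ≤ 0` on `(0,∞)`, vanishes identically. [new here — MODEL] -/
theorem hilbert_trivial_of_nonpos_on_Ioi (cω cl a ε K : ℝ) (U Om dOm ddOm : ℝ → ℝ) (hcl : cl < cω) (hε : 0 ≤ ε)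
    (ha : a ≤ -1) (hodd : ∀ y, Om (-y) = -Om y) (hK : 0 ≤ K) (hLip : ∀ u v, |Om u - Om v| ≤ K * |u - v|)
    (hΩi : Integrable Om) (hΩ2 : MemLp Om 2)
    (hU : ∀ ξ, HasDerivAt U (hilbertTransform Om ξ) ξ) (hOm : ∀ ξ, HasDerivAt Om (dOm ξ) ξ)
    (hdOm : ∀ ξ, HasDerivAt dOm (ddOm ξ) ξ)
    (hF : ∀ ξ ∈ Ioi (0:ℝ), F1 cω cl a 1 ε (hilbertTransform Om) U Om dOm ddOm (fun _ => 0) ξ = 0)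
    (iHOm : IntegrableOn (fun ξ => hilbertTransform Om ξ * Om ξ) (Ioi 0))
    (iξd : IntegrableOn (fun ξ => ξ * dOm ξ) (Ioi 0)) (iUd : IntegrableOn (fun ξ => U ξ * dOm ξ) (Ioi 0))
    (idd : IntegrableOn ddOm (Ioi 0))
    (hξOm : Tendsto (fun ξ => ξ * Om ξ) atTop (𝓝 0)) (hUOm : Tendsto (fun ξ => U ξ * Om ξ) atTop (𝓝 0))
    (hdOmInf : Tendsto dOm atTop (𝓝 0)) (hsign : ∀ ξ ∈ Ioi (0:ℝ), Om ξ ≤ 0) : Om = 0 := by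
  have hOm0 : Om 0 = 0 := by
    have h := hodd 0
    rw [neg_zero] at h
    linarith
  have hpair := integral_Ioi_hilbertTransform_mul_nonpos hodd hK hLip hΩi hΩ2
  exact eq_zero_of_odd_of_eqOn_Ioi hodd
    (trivial_of_nonpos_on_Ioi cω cl a ε (hilbertTransform Om) U Om dOm ddOm hcl hε ha hU hOm hdOm hOm0 hF hΩi.integrableOn
      iHOm iξd iUd idd hξOm hUOm hdOmInf hsign hpair)

/-- **Mirror class EMPTY for `a ≥ −1` (genuine Hilbert transform).** Same setting with `a ≥ −1` and `Ω ≥ 0` on `(0,∞)`: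
`Ω ≡ 0`. [new here — MODEL] -/
theorem hilbert_trivial_of_nonneg_on_Ioi (cω cl a ε K : ℝ) (U Om dOm ddOm : ℝ → ℝ) (hcl : cl < cω) (hε : 0 ≤ ε)
    (ha : -1 ≤ a) (hodd : ∀ y, Om (-y) = -Om y) (hK : 0 ≤ K) (hLip : ∀ u v, |Om u - Om v| ≤ K * |u - v|)
    (hΩi : Integrable Om) (hΩ2 : MemLp Om 2)
    (hU : ∀ ξ, HasDerivAt U (hilbertTransform Om ξ) ξ) (hOm : ∀ ξ, HasDerivAt Om (dOm ξ) ξ)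
    (hdOm : ∀ ξ, HasDerivAt dOm (ddOm ξ) ξ)
    (hF : ∀ ξ ∈ Ioi (0:ℝ), F1 cω cl a 1 ε (hilbertTransform Om) U Om dOm ddOm (fun _ => 0) ξ = 0)
    (iHOm : IntegrableOn (fun ξ => hilbertTransform Om ξ * Om ξ) (Ioi 0))
    (iξd : IntegrableOn (fun ξ => ξ * dOm ξ) (Ioi 0)) (iUd : IntegrableOn (fun ξ => U ξ * dOm ξ) (Ioi 0))
    (idd : IntegrableOn ddOm (Ioi 0))
    (hξOm : Tendsto (fun ξ => ξ * Om ξ) atTop (𝓝 0)) (hUOm : Tendsto (fun ξ => U ξ * Om ξ) atTop (𝓝 0))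
    (hdOmInf : Tendsto dOm atTop (𝓝 0)) (hsign : ∀ ξ ∈ Ioi (0:ℝ), 0 ≤ Om ξ) : Om = 0 := by
  have hOm0 : Om 0 = 0 := by
    have h := hodd 0
    rw [neg_zero] at h
    linarith
  have hpair := integral_Ioi_hilbertTransform_mul_nonpos hodd hK hLip hΩi hΩ2
  exact eq_zero_of_odd_of_eqOn_Ioi hodd
    (trivial_of_nonneg_on_Ioi cω cl a ε (hilbertTransform Om) U Om dOm ddOm hcl hε ha hU hOm hdOm hOm0 hF hΩi.integrableOn
      iHOm iξd iUd idd hξOm hUOm hdOmInf hsign hpair)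

/-- **At `a = −1` no one-signed profile (genuine Hilbert transform).** [new here — MODEL] -/
theorem hilbert_trivial_of_oneSigned_of_a_eq_neg_one (cω cl ε K : ℝ) (U Om dOm ddOm : ℝ → ℝ) (hcl : cl < cω)
    (hε : 0 ≤ ε) (hodd : ∀ y, Om (-y) = -Om y) (hK : 0 ≤ K) (hLip : ∀ u v, |Om u - Om v| ≤ K * |u - v|)
    (hΩi : Integrable Om) (hΩ2 : MemLp Om 2)
    (hU : ∀ ξ, HasDerivAt U (hilbertTransform Om ξ) ξ) (hOm : ∀ ξ, HasDerivAt Om (dOm ξ) ξ)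
    (hdOm : ∀ ξ, HasDerivAt dOm (ddOm ξ) ξ)
    (hF : ∀ ξ ∈ Ioi (0:ℝ), F1 cω cl (-1) 1 ε (hilbertTransform Om) U Om dOm ddOm (fun _ => 0) ξ = 0)
    (iHOm : IntegrableOn (fun ξ => hilbertTransform Om ξ * Om ξ) (Ioi 0))
    (iξd : IntegrableOn (fun ξ => ξ * dOm ξ) (Ioi 0)) (iUd : IntegrableOn (fun ξ => U ξ * dOm ξ) (Ioi 0))
    (idd : IntegrableOn ddOm (Ioi 0))
    (hξOm : Tendsto (fun ξ => ξ * Om ξ) atTop (𝓝 0)) (hUOm : Tendsto (fun ξ => U ξ * Om ξ) atTop (𝓝 0))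
    (hdOmInf : Tendsto dOm atTop (𝓝 0))
    (hsign : (∀ ξ ∈ Ioi (0:ℝ), 0 ≤ Om ξ) ∨ (∀ ξ ∈ Ioi (0:ℝ), Om ξ ≤ 0)) : Om = 0 := by
  rcases hsign with h | h
  · exact hilbert_trivial_of_nonneg_on_Ioi cω cl (-1) ε K U Om dOm ddOm hcl hε (by norm_num) hodd hK hLip hΩi hΩ2 hU hOm
      hdOm hF iHOm iξd iUd idd hξOm hUOm hdOmInf h
  · exact hilbert_trivial_of_nonpos_on_Ioi cω cl (-1) ε K U Om dOm ddOm hcl hε (by norm_num) hodd hK hLip hΩi hΩ2 hU hOm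
      hdOm hF iHOm iξd iUd idd hξOm hUOm hdOmInf h

/-- **THE NS-TYPE LINE FORM (census decl).** On the NS-type line `c_l = c_ω/2` of the gCLM/OSW sheet (constant viscosity,
`Literature.Analysis.FluidPDE.effectiveViscosity_half`; blow-up `c_ω > 0`, any gauge, any `ε ≥ 0`) and for every `a ≤ −1`, an odd
`K`-Lipschitz `Ω ∈ L¹ ∩ L²`, `C²`, E-SIGNED (`Ω ≤ 0` on `(0,∞)`) solution with the genuine Hilbert transform, in the decay class of
(★), is `≡ 0` — the kernel companion of CENSUS-Z3 row Z3-E12⁻'s «a ≤ −1 EMPTY in PRINT». [new here — MODEL] -/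
theorem nsTypeLine_ESigned_empty_of_a_le_neg_one (cω a ε K : ℝ) (U Om dOm ddOm : ℝ → ℝ) (hcω : 0 < cω) (hε : 0 ≤ ε)
    (ha : a ≤ -1) (hodd : ∀ y, Om (-y) = -Om y) (hK : 0 ≤ K) (hLip : ∀ u v, |Om u - Om v| ≤ K * |u - v|)
    (hΩi : Integrable Om) (hΩ2 : MemLp Om 2)
    (hU : ∀ ξ, HasDerivAt U (hilbertTransform Om ξ) ξ) (hOm : ∀ ξ, HasDerivAt Om (dOm ξ) ξ)
    (hdOm : ∀ ξ, HasDerivAt dOm (ddOm ξ) ξ)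
    (hF : ∀ ξ ∈ Ioi (0:ℝ), F1 cω (cω / 2) a 1 ε (hilbertTransform Om) U Om dOm ddOm (fun _ => 0) ξ = 0)
    (iHOm : IntegrableOn (fun ξ => hilbertTransform Om ξ * Om ξ) (Ioi 0))
    (iξd : IntegrableOn (fun ξ => ξ * dOm ξ) (Ioi 0)) (iUd : IntegrableOn (fun ξ => U ξ * dOm ξ) (Ioi 0))
    (idd : IntegrableOn ddOm (Ioi 0))
    (hξOm : Tendsto (fun ξ => ξ * Om ξ) atTop (𝓝 0)) (hUOm : Tendsto (fun ξ => U ξ * Om ξ) atTop (𝓝 0))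
    (hdOmInf : Tendsto dOm atTop (𝓝 0)) (hsign : ∀ ξ ∈ Ioi (0:ℝ), Om ξ ≤ 0) : Om = 0 :=
  hilbert_trivial_of_nonpos_on_Ioi cω (cω / 2) a ε K U Om dOm ddOm (by linarith) hε ha hodd hK hLip hΩi hΩ2 hU hOm hdOm hF
    iHOm iξd iUd idd hξOm hUOm hdOmInf hsign

end SheetHalfLine
end Summit.NavierStokesRegularity.OSWSelfSimilar
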